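/-
Origin: expansion seat `planner-pub-hodgecm-mc-axioms-1-g14-0`, handover #W143 2026-08-20T15:53:55Z md5 d808e901ee6a (PKG bdd1db57416f → d808e901ee6a; 273 l.; MECHANICAL (iib-R) rewrite v3.1 of the PKG file as it stands (106 token edits; rules R1x1+RX[h₂']x105)) (`HOME/mc/pub-hodgecm-mc-axioms-1-g14/revendor/kit-r55/stage55/HodgeCM/Model/ThetaGenExports.lean`, md5 d808e901ee6a, 273 lines);
landed by the gen-22 packager (p-g22) in gate run 55 REPLACES the earlier landed copy of `HodgeCM/Model/ThetaGenExports.lean` (seat copy carried the packager Origin header of an earlier run (stripped)).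
-/
/-
RUN-38 (L3)/(L3b) `Level`-PAIR RE-CUT DRAFT by `planner-pub-hodgecm-mc-theta-3-g10-0` 2026-08-19 over RUN-37 kit #S11 d6e312eb92e4: + (T4)
UNCONDITIONAL IN THE DATA `S`: `exists_adm₃₄_coe_eq_rightTranslate_of_le` = `…_of_mem_Gfin` with `hGfin := S.fin_mem_Gfin hV kf` and
`hcorr := S.exists_corrector_of_mem_levelImage … Γ hV` (the two new PIN FIELDS of `Model/ThetaSpaceInputPin` r38); everything else
byte-identical to #S11.
-/
/-
Origin: CONSTRUCTION seat `planner-pub-hodgecm-mc-theta-3-g9-0` (unit pub-hodgecm-mc-theta-3-g9, gen 9 of mc-theta-3 — theta supply /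
second-lift lane; (Θ-sat) RUN-37 pin-packet owner), 2026-08-19.  NEW additive leaf `HodgeCM/Model/ThetaGenExports.lean`
(RUN-37 kit `t37-mctheta3g9.txt` row #S11): the ADMISSIBILITY PREDICATE OF RECORD `adm₃₄` (model1 BINDER-TRIAGE §69.1, verbatim:
saturated at `sat(K_Γ)` ∧ strict ∧ `IsHolType`) and the four theta-lane EXPORTS binder-1's kit #17 `Model/Binders/Real34LocOfThetaGen`
(`Real34Loc.ofThetaGen adm hsat hΘge hhol htransl`) consumes, in binder-1's binder shapes: (T1) `hsat`, (T2) `hΘge`, (T3) `hhol`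
— one-liners over this lineage's kit rows #S1/#S8/#S9 — and (T4) `htransl` in the form «an `adm₃₄`-admissible situation at the
conjugated level whose theta forms contain the finite-adelic right translate» over the (T4) ENGINE (#S10), with the saturation
conjugation `hK` DISCHARGED (kit #S6) under binder-1's hypothesis `K_Γ ≤ k_f⁻¹ K_{Γ'} k_f`; the two residual hypotheses are exactly
model1 §69.2's: `hh` (the translating element centralises the archimedean component) and `hcorr` (level correctors inside the
saturation subgroup = the (L3) pin field `rat_split_level`, next `ThetaAdelicSide` re-cut).  Imports: #S10, #S6, vendored `LevelOrbitConjugation` (`conjLevel`).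
0 records, nothing cited, 0 proof-hole; ONE `def … : Prop` (`adm₃₄`, a binder VALUE, not a claim); expected `#print axioms` ⊆
{propext, Classical.choice, Quot.sound}.
-/
import Summits.HodgeConjecture.HodgeCM.Model.ThetaSpaceSatRightTranslate
import Summits.HodgeConjecture.HodgeCM.Model.Junction.LevelSaturationConj
import Literature.NumberTheory.Automorphic.LevelOrbitConjugation

/-!
# Theta-lane exports for `Real34Loc.ofThetaGen` at `adm₃₄`

`𝕏 = thetaSpaceInputIn hHD hI h₁ h₃ S h` is the (Θ-sat) pin (`Model/ThetaSpaceInputPin`): `(𝕏).KΓ Γ = satLevelRegimeOf V h Γ.K`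
(binder-1's `satSubgroup V hV Γ`), `(𝕏).Θ k Γ = thetaSpaceSatOf …`, `(𝕏).Δ Γ = levelImage … Γ h`, `(𝕏).ιinf _ = S.ιinf`.

* `adm₃₄ S h Γ k Sit := Sit.IsSaturated ((𝕏).KΓ Γ) ∧ Sit.IsStrict ∧ IsHolType … Γ k Sit ((𝕏).P k).weightFunctions`.
* (T1) `hsat_of_adm₃₄`   — admissible ⇒ saturated at `satLevelRegimeOf V h Γ.K` (definitional).
* (T2) `forms_le_Θ_of_adm₃₄` — admissible ⇒ `Sit.forms 𝓕₀ ≤ (𝕏).Θ k Γ` (#S1 `forms_le_thetaSpaceSatOf`).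
* (T3) `restrictHom_mem_Hol_of_adm₃₄` — admissible ⇒ archimedean restrictions of theta forms are holomorphic (#S9).
* `finTranslate V hV kf := e(1, k_f⁻¹)` typed at `(V.latticeModel _).G`; `inv_mul_mul_mem_satLevelRegimeOf_of_le_conjLevel` —
  `K_Γ ≤ k_f⁻¹ K_{Γ'} k_f ⇒ e(1,k_f⁻¹)⁻¹ · sat(K_Γ) · e(1,k_f⁻¹) ⊆ sat(K_{Γ'})` (#S6).
* (T4) `exists_adm₃₄_coe_eq_rightTranslate` (any central `hfin`, hypotheses `hh hK hcorr`),
  `exists_adm₃₄_coe_eq_rightTranslate_fin` (`hfin = e(1, k_f⁻¹)`, `hK` discharged; hypotheses `hh`, `hcorr` in the concrete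
  spelling `S.ιinf` / `satLevelRegimeOf` / `levelImage` / `Γ_{G}`) and `exists_adm₃₄_coe_eq_rightTranslate_of_mem_Gfin`
  (`hh` discharged from `S.comm_fin` given `e(1, k_f⁻¹) ∈ S.Gfin`; residual hypotheses `hGfin`, `hcorr` = properties of the DATA `S`).
-/

set_option autoImplicit false

noncomputable section

open Literature.Geometry.ComplexHyperbolic.BallModel (U21 Ball x₀)
open Literature.NumberTheory.Automorphic Literature.NumberTheory.Weil1964
open Literature.NumberTheory.Automorphic.WeightForms (restrictHom IsLevelCorrected IsWeightMatched)
open Literature.NumberTheory.Automorphic.LevelOrbit (conjLevel)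
open Literature.NumberTheory.Automorphic.UnitaryGroup (cmAdelicProdEquiv)
open Literature.AlgebraicGeometry.HodgeTheory
open Literature.AlgebraicGeometry.ShimuraVarieties
open Literature.NumberTheory.Automorphic.PicardCM
open HodgeCM.PerL34.Seesaw
open HodgeCM.Model.SupplyInstance HodgeCM.Model.SupplyResidual
open HodgeCM.Model.ThetaSpace

namespace HodgeCM
namespace Model

/-! ### § 1. Level algebra: conjugating the saturation subgroup by `e(1, k_f⁻¹)` -/

section LevelAlgebra

variable {L : CMField} {ι₁ : L →+* ℂ} (V : HermSpace3 L ι₁) (hV : IsAnisotropic L V.Hm)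

/-- `Adelic.regimeEquiv` TYPED on the tree currency `↥(adelicUnitaryGroup L V.Hm)` and the pair data's group
`(V.latticeModel _).G` (both agree with the untyped ends by `rfl`; the ascription lets `map_inv`/instance search meet the
canonical instances — mc-discharge-1's / binder-1's `regimeEquivT` device, under a theta-lane name to avoid a clash). -/
abbrev regimeEquivPair :
    ↥(Literature.NumberTheory.Automorphic.adelicUnitaryGroup (L : Type) V.Hm) ≃ₜ*
      (V.latticeModel printFact_unitaryCompact_holds).G :=
  HodgeCM.Adelic.regimeEquiv L V.Hm hV

/-- **`e(1, k_f⁻¹) ∈ G_U(𝔸)`** — the finite-adelic translating element of (T4) in the regime model, TYPED at the pair data's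
group `(V.latticeModel _).G` (so that products with `S.ιinf _` and with arguments of theta forms elaborate homogeneously;
reducibly binder-1's `regimeEquivT V hV ((cmAdelicProdEquiv L 3 V.Hm).symm (1, kf⁻¹))`). -/
abbrev finTranslate (kf : V.adelicFin) : (V.latticeModel printFact_unitaryCompact_holds).G :=
  regimeEquivPair V hV ((cmAdelicProdEquiv (L : Type) 3 V.Hm).symm (1, kf⁻¹))

/-- the finite component of `e(1, k_f⁻¹)⁻¹` is `k_f` (stated in the spelling of kit #S6 `conj_mem_satLevelRegimeOf`) -/
theorem snd_cmAdelicProdEquiv_symm_finTranslate_inv (kf : V.adelicFin) :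
    (cmAdelicProdEquiv (L : Type) 3 V.Hm
        ((HodgeCM.Adelic.regimeEquiv L V.Hm hV).symm (finTranslate V hV kf)⁻¹)).2 = kf := by
  show (cmAdelicProdEquiv (L : Type) 3 V.Hm ((regimeEquivPair V hV).symm
      (regimeEquivPair V hV ((cmAdelicProdEquiv (L : Type) 3 V.Hm).symm (1, kf⁻¹)))⁻¹)).2 = kf
  rw [← map_inv (regimeEquivPair V hV), ContinuousMulEquiv.symm_apply_apply,
    map_inv (cmAdelicProdEquiv (L : Type) 3 V.Hm), ContinuousMulEquiv.apply_symm_apply, Prod.snd_inv, inv_inv]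

/-- **`hK` of (T4), discharged.**  If `K_Γ ≤ k_f⁻¹ K_{Γ'} k_f` (`conjLevel Γ'.K kf⁻¹`, binder-1's hypothesis of `htransl`), then
`e(1, k_f⁻¹)⁻¹ · satLevelRegimeOf V hV Γ.K · e(1, k_f⁻¹) ⊆ satLevelRegimeOf V hV Γ'.K` (kit #S6 `conj_mem_satLevelRegimeOf` at
`k := e(1, k_f⁻¹)⁻¹`, whose finite component is `k_f`). -/
theorem inv_mul_mul_mem_satLevelRegimeOf_of_le_conjLevel {Γ Γ' : Level V} (kf : V.adelicFin)
    (hle : Γ.K ≤ conjLevel Γ'.K kf⁻¹) {a : (V.latticeModel printFact_unitaryCompact_holds).G}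
    (ha : a ∈ satLevelRegimeOf V hV Γ.K) :
    (finTranslate V hV kf)⁻¹ * a * finTranslate V hV kf ∈ satLevelRegimeOf V hV Γ'.K := by
  have hmain := conj_mem_satLevelRegimeOf V hV (K := Γ'.K) (K' := Γ.K) (finTranslate V hV kf)⁻¹
    (fun b hb => by
      obtain ⟨b', hb', rfl⟩ := Subgroup.mem_map.1 (hle hb)
      rw [snd_cmAdelicProdEquiv_symm_finTranslate_inv, MulEquiv.coe_toMonoidHom, MulAut.conj_apply, inv_inv,
        ← mul_assoc, ← mul_assoc, mul_inv_cancel, one_mul, mul_assoc, mul_inv_cancel, mul_one]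
      exact hb') ha
  rwa [inv_inv] at hmain

end LevelAlgebra

/-! ### § 2. The admissibility predicate of record and the exports -/

section Pin

variable (hHD : exists_isReal_hodgeModel) (hI : hodgePQ_independent_of_hodgeModel)
  (h₁ : BallQuotientUniformised)  (h₃ : CMAbelianVarietyRealised)

variable {L : CMField} {ι₁ : L →+* ℂ} {V : HermSpace3 L ι₁} {c : SeesawCtx L}

/-- **`adm₃₄`** — binder-1's admissibility predicate for the generating theta forms of the (34) junction
(model1 BINDER-TRIAGE §69.1, verbatim): the `K`-type situation is SATURATED at the pin's saturation subgroup
`(𝕏).KΓ Γ = satLevelRegimeOf V h Γ.K`, STRICT, and of HOLOMORPHIC TYPE (#S9 `IsHolType`) for the pair's weight functions. -/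
def adm₃₄ (S : ThetaAdelicSide V c) (h : IsAnisotropic L V.Hm) (Γ : Level V) (k : Fin 4)
    (Sit : KTypeSituation ((thetaSpaceInputIn hHD hI h₁ h₃ S h).P k)
      ((thetaSpaceInputIn hHD hI h₁ h₃ S h).ιinf Γ) ((thetaSpaceInputIn hHD hI h₁ h₃ S h).Δ Γ)
      (thetaSpaceInputIn hHD hI h₁ h₃ S h).κ₁ (thetaSpaceInputIn hHD hI h₁ h₃ S h).τ₁) : Prop :=
  Sit.IsSaturated ((thetaSpaceInputIn hHD hI h₁ h₃ S h).KΓ Γ) ∧ Sit.IsStrict ∧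
    IsHolType hHD hI h₁ h₃ S h Γ k Sit ((thetaSpaceInputIn hHD hI h₁ h₃ S h).P k).weightFunctions

/-- **(T1) `hsat`.**  An admissible situation is saturated at `satLevelRegimeOf V h Γ.K` (binder-1's `satSubgroup V hV Γ`):
definitional (`thetaSpaceInputIn_KΓ`). -/
theorem hsat_of_adm₃₄ (S : ThetaAdelicSide V c) (h : IsAnisotropic L V.Hm) (Γ : Level V) (k : Fin 4)
    (Sit : KTypeSituation ((thetaSpaceInputIn hHD hI h₁ h₃ S h).P k)
      ((thetaSpaceInputIn hHD hI h₁ h₃ S h).ιinf Γ) ((thetaSpaceInputIn hHD hI h₁ h₃ S h).Δ Γ)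
      (thetaSpaceInputIn hHD hI h₁ h₃ S h).κ₁ (thetaSpaceInputIn hHD hI h₁ h₃ S h).τ₁)
    (hadm : adm₃₄ hHD hI h₁ h₃ S h Γ k Sit) :
    ∀ g ∈ satLevelRegimeOf V h Γ.K, ∃ c' : Sit.Kc, Sit.κ c' = g ∧ Sit.τ c' = 1 :=
  hadm.1

/-- **(T2) `hΘge`.**  The restricted forms of an admissible situation lie in the pin's classical theta space
`(𝕏).Θ k Γ = thetaSpaceSatOf …` (#S1 `forms_le_thetaSpaceSatOf`). -/
theorem forms_le_Θ_of_adm₃₄ (S : ThetaAdelicSide V c) (h : IsAnisotropic L V.Hm) (Γ : Level V) (k : Fin 4)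
    (Sit : KTypeSituation ((thetaSpaceInputIn hHD hI h₁ h₃ S h).P k)
      ((thetaSpaceInputIn hHD hI h₁ h₃ S h).ιinf Γ) ((thetaSpaceInputIn hHD hI h₁ h₃ S h).Δ Γ)
      (thetaSpaceInputIn hHD hI h₁ h₃ S h).κ₁ (thetaSpaceInputIn hHD hI h₁ h₃ S h).τ₁)
    (hadm : adm₃₄ hHD hI h₁ h₃ S h Γ k Sit) :
    Sit.forms ((thetaSpaceInputIn hHD hI h₁ h₃ S h).P k).weightFunctions ≤
      (thetaSpaceInputIn hHD hI h₁ h₃ S h).Θ k Γ :=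
  forms_le_thetaSpaceSatOf Sit hadm.1 hadm.2.1 _

/-- **(T3) `hhol`.**  The archimedean restrictions of the theta forms of an admissible situation are holomorphic
(#S9 `restrictHom_mem_D_Hol_of_isHolType`). -/
theorem restrictHom_mem_Hol_of_adm₃₄ (S : ThetaAdelicSide V c) (h : IsAnisotropic L V.Hm) (Γ : Level V) (k : Fin 4)
    (Sit : KTypeSituation ((thetaSpaceInputIn hHD hI h₁ h₃ S h).P k)
      ((thetaSpaceInputIn hHD hI h₁ h₃ S h).ιinf Γ) ((thetaSpaceInputIn hHD hI h₁ h₃ S h).Δ Γ)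
      (thetaSpaceInputIn hHD hI h₁ h₃ S h).κ₁ (thetaSpaceInputIn hHD hI h₁ h₃ S h).τ₁)
    (hadm : adm₃₄ hHD hI h₁ h₃ S h Γ k Sit) :
    ∀ θ ∈ Sit.thetaForms ((thetaSpaceInputIn hHD hI h₁ h₃ S h).P k).weightFunctions,
      restrictHom ((thetaSpaceInputIn hHD hI h₁ h₃ S h).ιinf Γ) Sit.hΔ Sit.hη θ ∈
        ((thetaSpaceInputIn hHD hI h₁ h₃ S h).D Γ).Hol :=
  restrictHom_mem_D_Hol_of_isHolType hHD hI h₁ h₃ S h Γ k Sit _ hadm.2.2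

/-- **(T4), abstract translating element.**  For an admissible situation `Sit` at level `Γ'` and `hfin ∈ G_U(𝔸)` centralising
`ιinf (U(2,1))` (`hh`), conjugating `sat(K_Γ)` into `sat(K_{Γ'})` (`hK`) and with level correctors for `Γ` inside `sat(K_Γ)`
(`hcorr`), every theta form `θ` of `Sit` has its right translate `g ↦ θ (g · hfin)` among the theta forms of an ADMISSIBLE
situation at level `Γ` (#S10 `exists_saturated_strict_holType_rightTranslate`). -/
theorem exists_adm₃₄_coe_eq_rightTranslate (S : ThetaAdelicSide V c) (h : IsAnisotropic L V.Hm) (Γ' Γ : Level V)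
    (k : Fin 4)
    (Sit : KTypeSituation ((thetaSpaceInputIn hHD hI h₁ h₃ S h).P k)
      ((thetaSpaceInputIn hHD hI h₁ h₃ S h).ιinf Γ') ((thetaSpaceInputIn hHD hI h₁ h₃ S h).Δ Γ')
      (thetaSpaceInputIn hHD hI h₁ h₃ S h).κ₁ (thetaSpaceInputIn hHD hI h₁ h₃ S h).τ₁)
    {hfin : (thetaSpaceInputIn hHD hI h₁ h₃ S h).GU}
    (hh : ∀ x : U21, Commute hfin ((thetaSpaceInputIn hHD hI h₁ h₃ S h).ιinf Γ' x))
    (hK : ∀ a ∈ (thetaSpaceInputIn hHD hI h₁ h₃ S h).KΓ Γ,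
      hfin⁻¹ * a * hfin ∈ (thetaSpaceInputIn hHD hI h₁ h₃ S h).KΓ Γ')
    (hcorr : ∀ δ ∈ (thetaSpaceInputIn hHD hI h₁ h₃ S h).Δ Γ, ∃ x ∈ (thetaSpaceInputIn hHD hI h₁ h₃ S h).KΓ Γ,
      (thetaSpaceInputIn hHD hI h₁ h₃ S h).ιinf Γ' δ * x ∈ ((thetaSpaceInputIn hHD hI h₁ h₃ S h).P k).ΓU ∧
        ∀ y : U21, Commute x ((thetaSpaceInputIn hHD hI h₁ h₃ S h).ιinf Γ' y))
    (hadm : adm₃₄ hHD hI h₁ h₃ S h Γ' k Sit) :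
    ∀ θ ∈ Sit.thetaForms ((thetaSpaceInputIn hHD hI h₁ h₃ S h).P k).weightFunctions,
      ∃ Sit' : KTypeSituation ((thetaSpaceInputIn hHD hI h₁ h₃ S h).P k)
          ((thetaSpaceInputIn hHD hI h₁ h₃ S h).ιinf Γ) ((thetaSpaceInputIn hHD hI h₁ h₃ S h).Δ Γ)
          (thetaSpaceInputIn hHD hI h₁ h₃ S h).κ₁ (thetaSpaceInputIn hHD hI h₁ h₃ S h).τ₁,
        adm₃₄ hHD hI h₁ h₃ S h Γ k Sit' ∧
          ∃ θ' ∈ Sit'.thetaForms ((thetaSpaceInputIn hHD hI h₁ h₃ S h).P k).weightFunctions,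
            θ'.1 = fun g => θ.1 (g * hfin) := by
  intro θ hθ
  obtain ⟨Sit', hS', hstr', hhol', hθ'⟩ := exists_saturated_strict_holType_rightTranslate hHD hI h₁ h₃ S h Γ' Γ k
    Sit hh hadm.1 hadm.2.1 hK hcorr _ hadm.2.2
  exact ⟨Sit', ⟨hS', hstr', hhol'⟩, hθ' θ hθ⟩

/-- **(T4) at `hfin = e(1, k_f⁻¹)`**, `hK` discharged: for an admissible situation `Sit` at `Γ'`, a finite-adelic `k_f` with
`K_Γ ≤ k_f⁻¹ K_{Γ'} k_f` (binder-1's hypothesis of `htransl`), the right translate `g ↦ θ (g · e(1, k_f⁻¹))` of every theta form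
`θ` of `Sit` is a theta form of an ADMISSIBLE situation at level `Γ`, PROVIDED (model1 §69.2) `hh`: `e(1, k_f⁻¹)` commutes with
`S.ιinf (U(2,1))` and `hcorr`: every `δ ∈ levelImage Γ` has a corrector `x ∈ satLevelRegimeOf V h Γ.K` with `S.ιinf δ · x`
rational and `x` commuting with `S.ιinf (U(2,1))` (the (L3) pin field `rat_split_level` read at `Γ`). -/
theorem exists_adm₃₄_coe_eq_rightTranslate_fin (S : ThetaAdelicSide V c) (h : IsAnisotropic L V.Hm) (Γ' Γ : Level V)
    (k : Fin 4)
    (Sit : KTypeSituation ((thetaSpaceInputIn hHD hI h₁ h₃ S h).P k)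
      ((thetaSpaceInputIn hHD hI h₁ h₃ S h).ιinf Γ') ((thetaSpaceInputIn hHD hI h₁ h₃ S h).Δ Γ')
      (thetaSpaceInputIn hHD hI h₁ h₃ S h).κ₁ (thetaSpaceInputIn hHD hI h₁ h₃ S h).τ₁)
    (kf : V.adelicFin) (hle : Γ.K ≤ conjLevel Γ'.K kf⁻¹)
    (hh : ∀ x : U21, Commute (finTranslate V h kf) (S.ιinf x))
    (hcorr : ∀ δ ∈ levelImage hHD hI h₁ h₃ Γ h, ∃ x : (V.latticeModel printFact_unitaryCompact_holds).G,
      x ∈ satLevelRegimeOf V h Γ.K ∧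
        S.ιinf δ * x ∈ (V.latticeModel printFact_unitaryCompact_holds).Γ ∧ ∀ y : U21, Commute x (S.ιinf y))
    (hadm : adm₃₄ hHD hI h₁ h₃ S h Γ' k Sit) :
    ∀ θ ∈ Sit.thetaForms ((thetaSpaceInputIn hHD hI h₁ h₃ S h).P k).weightFunctions,
      ∃ Sit' : KTypeSituation ((thetaSpaceInputIn hHD hI h₁ h₃ S h).P k)
          ((thetaSpaceInputIn hHD hI h₁ h₃ S h).ιinf Γ) ((thetaSpaceInputIn hHD hI h₁ h₃ S h).Δ Γ)
          (thetaSpaceInputIn hHD hI h₁ h₃ S h).κ₁ (thetaSpaceInputIn hHD hI h₁ h₃ S h).τ₁,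
        adm₃₄ hHD hI h₁ h₃ S h Γ k Sit' ∧
          ∃ θ' ∈ Sit'.thetaForms ((thetaSpaceInputIn hHD hI h₁ h₃ S h).P k).weightFunctions,
            θ'.1 = fun g : (V.latticeModel printFact_unitaryCompact_holds).G => θ.1 (g * finTranslate V h kf) := by
  refine exists_adm₃₄_coe_eq_rightTranslate hHD hI h₁ h₃ S h Γ' Γ k Sit (hfin := finTranslate V h kf)
    hh (fun a ha => inv_mul_mul_mem_satLevelRegimeOf_of_le_conjLevel V h kf hle ha) (fun δ hδ => ?_) hadm
  obtain ⟨x, hx, hxΓ, hxc⟩ := hcorr δ hδ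
  refine ⟨x, hx, ?_, hxc⟩
  rw [thetaSpaceInputIn_P, S.hΓU k]
  exact hxΓ

/-- **(T4) at `hfin = e(1, k_f⁻¹) ∈ S.Gfin`**: as `exists_adm₃₄_coe_eq_rightTranslate_fin`, with `hh` DISCHARGED from the pin's
`comm_fin` once `e(1, k_f⁻¹)` is known to lie in the finite factor `S.Gfin` (true for the honest adelic side; for the abstract
pin it is the membership the (L3) re-cut of `ThetaAdelicSide` pins together with `rat_split_level`).  Residual hypotheses:
`hGfin`, `hcorr` — both properties of the DATA `S`, none about theta functions. -/
theorem exists_adm₃₄_coe_eq_rightTranslate_of_mem_Gfin (S : ThetaAdelicSide V c) (h : IsAnisotropic L V.Hm)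
    (Γ' Γ : Level V) (k : Fin 4)
    (Sit : KTypeSituation ((thetaSpaceInputIn hHD hI h₁ h₃ S h).P k)
      ((thetaSpaceInputIn hHD hI h₁ h₃ S h).ιinf Γ') ((thetaSpaceInputIn hHD hI h₁ h₃ S h).Δ Γ')
      (thetaSpaceInputIn hHD hI h₁ h₃ S h).κ₁ (thetaSpaceInputIn hHD hI h₁ h₃ S h).τ₁)
    (kf : V.adelicFin) (hle : Γ.K ≤ conjLevel Γ'.K kf⁻¹) (hGfin : finTranslate V h kf ∈ S.Gfin)
    (hcorr : ∀ δ ∈ levelImage hHD hI h₁ h₃ Γ h, ∃ x : (V.latticeModel printFact_unitaryCompact_holds).G,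
      x ∈ satLevelRegimeOf V h Γ.K ∧
        S.ιinf δ * x ∈ (V.latticeModel printFact_unitaryCompact_holds).Γ ∧ ∀ y : U21, Commute x (S.ιinf y))
    (hadm : adm₃₄ hHD hI h₁ h₃ S h Γ' k Sit) :
    ∀ θ ∈ Sit.thetaForms ((thetaSpaceInputIn hHD hI h₁ h₃ S h).P k).weightFunctions,
      ∃ Sit' : KTypeSituation ((thetaSpaceInputIn hHD hI h₁ h₃ S h).P k)
          ((thetaSpaceInputIn hHD hI h₁ h₃ S h).ιinf Γ) ((thetaSpaceInputIn hHD hI h₁ h₃ S h).Δ Γ)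
          (thetaSpaceInputIn hHD hI h₁ h₃ S h).κ₁ (thetaSpaceInputIn hHD hI h₁ h₃ S h).τ₁,
        adm₃₄ hHD hI h₁ h₃ S h Γ k Sit' ∧
          ∃ θ' ∈ Sit'.thetaForms ((thetaSpaceInputIn hHD hI h₁ h₃ S h).P k).weightFunctions,
            θ'.1 = fun g : (V.latticeModel printFact_unitaryCompact_holds).G => θ.1 (g * finTranslate V h kf) :=
  exists_adm₃₄_coe_eq_rightTranslate_fin hHD hI h₁ h₃ S h Γ' Γ k Sit kf hle (fun x => S.comm_fin x _ hGfin) hcorr hadm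

/-- **(T4) at the pin, UNCONDITIONAL in the data `S`** (RUN-38 (L3)/(L3b) `Level`-pair packet): for `Γ.K ≤ k_f Γ'.K k_f⁻¹`,
every theta form of an admissible situation at level `Γ'` has its right translate by `e(1, k_f⁻¹)` among the theta forms of an
admissible situation at level `Γ` — the two residual hypotheses of `exists_adm₃₄_coe_eq_rightTranslate_of_mem_Gfin` are now
the PIN FIELDS `S.fin_mem_Gfin` ((L3b)) and `S.rat_split_level` ((L3), through
`ThetaAdelicSide.exists_corrector_of_mem_levelImage`) of `Model/ThetaSpaceInputPin` (model1 §69.2: no new E binder). -/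
theorem exists_adm₃₄_coe_eq_rightTranslate_of_le (S : ThetaAdelicSide V c) (h : IsAnisotropic L V.Hm)
    (Γ' Γ : Level V) (k : Fin 4)
    (Sit : KTypeSituation ((thetaSpaceInputIn hHD hI h₁ h₃ S h).P k)
      ((thetaSpaceInputIn hHD hI h₁ h₃ S h).ιinf Γ') ((thetaSpaceInputIn hHD hI h₁ h₃ S h).Δ Γ')
      (thetaSpaceInputIn hHD hI h₁ h₃ S h).κ₁ (thetaSpaceInputIn hHD hI h₁ h₃ S h).τ₁)
    (kf : V.adelicFin) (hle : Γ.K ≤ conjLevel Γ'.K kf⁻¹)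
    (hadm : adm₃₄ hHD hI h₁ h₃ S h Γ' k Sit) :
    ∀ θ ∈ Sit.thetaForms ((thetaSpaceInputIn hHD hI h₁ h₃ S h).P k).weightFunctions,
      ∃ Sit' : KTypeSituation ((thetaSpaceInputIn hHD hI h₁ h₃ S h).P k)
          ((thetaSpaceInputIn hHD hI h₁ h₃ S h).ιinf Γ) ((thetaSpaceInputIn hHD hI h₁ h₃ S h).Δ Γ)
          (thetaSpaceInputIn hHD hI h₁ h₃ S h).κ₁ (thetaSpaceInputIn hHD hI h₁ h₃ S h).τ₁,
        adm₃₄ hHD hI h₁ h₃ S h Γ k Sit' ∧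
          ∃ θ' ∈ Sit'.thetaForms ((thetaSpaceInputIn hHD hI h₁ h₃ S h).P k).weightFunctions,
            θ'.1 = fun g : (V.latticeModel printFact_unitaryCompact_holds).G => θ.1 (g * finTranslate V h kf) :=
  exists_adm₃₄_coe_eq_rightTranslate_of_mem_Gfin hHD hI h₁ h₃ S h Γ' Γ k Sit kf hle (S.fin_mem_Gfin h kf)
    (S.exists_corrector_of_mem_levelImage hHD hI h₁ h₃ Γ h) hadm

end Pin

end Model
end HodgeCM

end
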